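import Literature.Analysis.Complex.LogDerivZerosDisc
import Literature.NumberTheory.LFunctions.ZetaZerosJensen
import HarnessLib

/-!
# `ζ'/ζ` near the critical strip: partial fraction, and bounds under RH

Trunk T-ANT support for the von Koch theorem `RH ⇒ ψ(x) = x + O(x^{1/2} log² x)`
(Montgomery–Vaughan Thm. 13.1; fact `Literature.NumberTheory.LFunctions.vonKoch_chebyshevPsi_of_riemannHypothesis`).
Everything in this file is PROVED.

* `exists_norm_logDeriv_zeta_sub_sum_le` (Montgomery–Vaughan Lemma 12.1, in the disc form of its
  proof; Titchmarsh Thm. 9.6 (A)): for `|T| ≥ 2` and `|s − (2 + iT)| ≤ 7/4`,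
  `ζ'/ζ(s) = ∑_ρ m(ρ)/(s − ρ) + O(log |T|)`, the sum over the zeros of `ζ` in
  `|ρ − (2 + iT)| ≤ 37/20` (Landau's lemma `Literature.Analysis.Complex.norm_logDeriv_sub_sum_le` on the discs of
  `ZetaZerosJensen.lean`, where `ζ ≪ |T|` and, by Jensen, the number of such zeros is `≪ log |T|`,
  `sum_divisor_zetaDisc_le`).
* `exists_goodHeight` (Montgomery–Vaughan Lemma 12.2, first half of the proof): every interval
  `[τ₀, τ₀ + 1]` contains a `T` with `|γ − T| ≫ 1/log(|T| + 2)` for all zeros `β + iγ`, `β ≥ 1/4`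
  (pigeonhole with `N(T + 1) − N(T) ≪ log T`, `exists_sum_zetaZeroWindow_le`).
* Under RH the zeros in these discs have `β = 1/2`, whence
  `norm_logDeriv_zeta_quarter_le` : `ζ'/ζ(1/4 + it) ≪ log(|t| + 2)` for all real `t`, and
  `norm_logDeriv_zeta_le_of_goodHeight` : `ζ'/ζ(σ + iT) ≪ log²(|T| + 2)` uniformly for
  `1/4 ≤ σ ≤ 2` at good heights `T` (Montgomery–Vaughan Lemma 12.2 restricted to `σ ≥ 1/4`, where
  under RH no functional equation is needed).

## References

* H. L. Montgomery, R. C. Vaughan, *Multiplicative Number Theory I. Classical Theory*, CUP 2007,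
  Lemma 12.1, Lemma 12.2 (pp. 398–399), Thm. 13.1.
* E. C. Titchmarsh, *The Theory of the Riemann Zeta-Function*, 2nd ed., OUP 1986, §3.9 Lemma α,
  Thm. 9.2, Thm. 9.6 (A).
-/

noncomputable section

open Complex Filter Set Metric MeromorphicOn Real
open scoped Topology

namespace Literature.NumberTheory.LFunctions

/-! ## Zeros under the Riemann hypothesis -/

/-- Under RH, a zero of `ζ` with positive real part lies on the critical line (the trivial zeros
`−2(n+1)` have negative real part; `1` is not a zero). [folklore] -/
theorem re_eq_one_half_of_riemannHypothesis (hRH : RiemannHypothesis) {ρ : ℂ}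
    (h0 : riemannZeta ρ = 0) (hρ : 0 < ρ.re) : ρ.re = 1 / 2 := by
  refine hRH ρ h0 ?_ (ne_one_of_riemannZeta_eq_zero h0)
  rintro ⟨n, hn⟩
  have : ρ.re = -2 * (n + 1) := by
    rw [hn]
    simp [mul_re]
  have hn0 : (0 : ℝ) ≤ n := n.cast_nonneg
  linarith

/-- Under RH, `ζ(s) ≠ 0` for `Re s > 0`, `Re s ≠ 1/2`. [folklore] -/
theorem riemannZeta_ne_zero_of_riemannHypothesis (hRH : RiemannHypothesis) {s : ℂ}
    (hs : 0 < s.re) (hs' : s.re ≠ 1 / 2) : riemannZeta s ≠ 0 := fun h0 ↦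
  hs' (re_eq_one_half_of_riemannHypothesis hRH h0 hs)

/-! ## The zeros in the disc `|s − (2 + iT)| ≤ 37/20` -/

/-- A point of the support of the divisor of `ζ` on the disc `|s − (2 + iT)| ≤ 37/20` (`|T| ≥ 2`)
is a zero of `ζ` in that disc, of positive multiplicity, with real part `≥ 3/20`. [folklore] -/
theorem zero_of_mem_support_divisor_zetaDisc {T : ℝ} (hT : 2 ≤ |T|) {u : ℂ}
    (hu : u ∈ Function.support (divisor riemannZeta (closedBall (2 + T * I) (37 / 20)))) :
    riemannZeta u = 0 ∧ 0 < divisor riemannZeta (closedBall (2 + T * I) (37 / 20)) u ∧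
      u ∈ closedBall (2 + T * I) (37 / 20) ∧ 3 / 20 ≤ u.re := by
  set U := closedBall (2 + (T : ℂ) * I) (37 / 20) with hU
  have huU : u ∈ U := (divisor riemannZeta U).supportWithinDomain hu
  have han : AnalyticOnNhd ℂ riemannZeta U := analyticOnNhd_riemannZeta_jensenDisc hT (by norm_num)
  have hu1 : u ≠ 1 := jensenDisc_ne_one hT (closedBall_subset_closedBall (by norm_num) huU)
  have hD : divisor riemannZeta U u = riemannZetaZeroOrder u :=
    (riemannZetaZeroOrder_eq_divisor han.meromorphicOn huU).symm
  rw [Function.mem_support, hD] at hu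
  have hpos : 0 < riemannZetaZeroOrder u :=
    lt_of_le_of_ne (riemannZetaZeroOrder_nonneg hu1) (Ne.symm hu)
  refine ⟨(riemannZetaZeroOrder_pos_iff hu1).1 hpos, by rwa [hD], huU, ?_⟩
  have hre : (2 + (T : ℂ) * I - u).re ≤ ‖2 + (T : ℂ) * I - u‖ := re_le_norm _
  rw [mem_closedBall, dist_eq_norm, norm_sub_rev] at huU
  simp only [sub_re, add_re, re_ofNat, mul_re, ofReal_re, I_re, mul_zero, ofReal_im, I_im,
    mul_one, sub_self, add_zero] at hre
  linarith

/-- `log 240 ≤ 6` (as `e > 2.7` and `2.7⁶ > 240`). [folklore] -/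
theorem log_two_hundred_forty_le : Real.log 240 ≤ 6 := by
  rw [← Real.log_exp 6]
  refine Real.log_le_log (by norm_num) ?_
  have h5 : (2.7 : ℝ) ^ 6 ≤ Real.exp 1 ^ 6 := by
    refine pow_le_pow_left₀ (by norm_num) ?_ 6
    have := Real.exp_one_gt_d9; linarith
  have h6 : Real.exp 1 ^ 6 = Real.exp 6 := by rw [← Real.exp_nat_mul]; norm_num
  rw [← h6]
  linarith [show (240 : ℝ) ≤ 2.7 ^ 6 by norm_num]

/-- `1 ≤ log(|T| + 2)` for `|T| ≥ 2` (indeed `|T| + 2 ≥ 4 > e`). [folklore] -/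
theorem one_le_log_abs_add_two {T : ℝ} (hT : 2 ≤ |T|) : 1 ≤ Real.log (|T| + 2) := by
  rw [← Real.log_exp 1]
  refine Real.log_le_log (Real.exp_pos 1) ?_
  have := Real.exp_one_lt_d9
  linarith

/-- The Jensen bound's numerator against `log(|T| + 2)`: `log(120(|T| + 4)) ≤ 7 log(|T| + 2)` for
`|T| ≥ 2`. [folklore] -/
theorem log_jensenBound_le {T : ℝ} (hT : 2 ≤ |T|) :
    Real.log (120 * (|T| + 4)) ≤ 7 * Real.log (|T| + 2) := by
  have hT0 : 0 ≤ |T| := abs_nonneg T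
  have hℓ := one_le_log_abs_add_two hT
  have h3 : Real.log (120 * (|T| + 4)) ≤ Real.log 240 + Real.log (|T| + 2) := by
    rw [← Real.log_mul (by norm_num) (by positivity)]
    exact Real.log_le_log (by positivity) (by nlinarith)
  linarith [log_two_hundred_forty_le]

/-- **The number of zeros in the disc** `|s − (2 + iT)| ≤ 37/20`, `|T| ≥ 2`, with multiplicity, is
`≪ log(|T| + 2)` (Jensen; `finsum_divisor_riemannZeta_closedBall_le`), here as a `Finset` sum over
the support of the divisor with an explicit constant. [cite: MontgomeryVaughan2007, Thm. 10.13 (proof)] -/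
theorem sum_divisor_zetaDisc_le {T : ℝ} (hT : 2 ≤ |T|) :
    ∑ u ∈ ((divisor riemannZeta (closedBall (2 + T * I) (37 / 20))).finiteSupport
        (isCompact_closedBall (2 + T * I) (37 / 20))).toFinset,
      (divisor riemannZeta (closedBall (2 + T * I) (37 / 20)) u : ℝ) ≤
      (7 / Real.log (39 / 37)) * Real.log (|T| + 2) := by
  set U := closedBall (2 + (T : ℂ) * I) (37 / 20) with hU
  set D := divisor riemannZeta U with hD
  have hfin := D.finiteSupport (isCompact_closedBall (2 + (T : ℂ) * I) (37 / 20))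
  have h1 := finsum_divisor_riemannZeta_closedBall_le hT (r := 37 / 20) (by norm_num) (by norm_num)
  rw [show (39 : ℝ) / 20 / (37 / 20) = 39 / 37 by norm_num] at h1
  have h2 : ∑ᶠ u, (D u : ℝ) = ∑ u ∈ hfin.toFinset, (D u : ℝ) := by
    apply finsum_eq_sum_of_support_subset
    intro u hu
    simp only [Finite.coe_toFinset, Function.mem_support, ne_eq]
    simpa using hu
  rw [← h2]
  refine h1.trans ?_
  have hlog0 : 0 < Real.log (39 / 37) := Real.log_pos (by norm_num)
  rw [div_mul_eq_mul_div, le_div_iff₀ hlog0, div_mul_cancel₀ _ hlog0.ne']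
  exact log_jensenBound_le hT

/-! ## The partial fraction of `ζ'/ζ` (Montgomery–Vaughan Lemma 12.1) -/

/-- **`ζ'/ζ` near height `T`** (Montgomery–Vaughan Lemma 12.1 in disc form; Titchmarsh Thm. 9.6
(A) / §3.9 Lemma α): there is an absolute `C > 0` such that for `|T| ≥ 2` and `|s − (2 + iT)| ≤ 7/4`
with `ζ(s) ≠ 0`,
`|ζ'/ζ(s) − ∑_ρ m(ρ)/(s − ρ)| ≤ C log(|T| + 2)`,
the sum over the zeros `ρ` of `ζ` in the disc `|ρ − (2 + iT)| ≤ 37/20` with their multiplicities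
(Mathlib's `divisor`). Landau's lemma on the discs `7/4 < 9/5 < 37/20 < 19/10` about `2 + iT`, with
`|ζ| ≤ 40(|T| + 4)` there, `|ζ(2 + iT)| ≥ 1/3`, and `∑ m(ρ) ≪ log |T|` (`sum_divisor_zetaDisc_le`).
[cite: MontgomeryVaughan2007, Lemma 12.1] -/
theorem exists_norm_logDeriv_zeta_sub_sum_le :
    ∃ C : ℝ, 0 < C ∧ ∀ T : ℝ, 2 ≤ |T| → ∀ z ∈ closedBall (2 + T * I) (7 / 4), riemannZeta z ≠ 0 →
      ‖deriv riemannZeta z / riemannZeta z -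
          ∑ u ∈ ((divisor riemannZeta (closedBall (2 + T * I) (37 / 20))).finiteSupport
              (isCompact_closedBall (2 + T * I) (37 / 20))).toFinset,
            (divisor riemannZeta (closedBall (2 + T * I) (37 / 20)) u : ℂ) / (z - u)‖ ≤
        C * Real.log (|T| + 2) := by
  have hlog0 : 0 < Real.log (39 / 37) := Real.log_pos (by norm_num)
  have hlog38 : 0 < Real.log 38 := Real.log_pos (by norm_num)
  refine ⟨1440 * (8 + 7 / Real.log (39 / 37) * Real.log 38), by positivity, ?_⟩
  intro T hT z hz hζz
  set c : ℂ := 2 + T * I with hc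
  have hT0 : 0 ≤ |T| := abs_nonneg T
  have hℓ : 1 ≤ Real.log (|T| + 2) := one_le_log_abs_add_two hT
  -- hypotheses of Landau's lemma
  have hf : AnalyticOnNhd ℂ riemannZeta (closedBall c (19 / 10)) :=
    analyticOnNhd_riemannZeta_jensenDisc hT (by norm_num)
  have hc0 : riemannZeta c ≠ 0 := riemannZeta_two_add_ne_zero T
  have hB : ∀ w ∈ closedBall c (19 / 10), ‖riemannZeta w‖ ≤ 40 * (|T| + 4) := fun w hw ↦
    norm_riemannZeta_le_of_mem_jensenDisc hT (closedBall_subset_closedBall (by norm_num) hw)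
  have hL := Literature.Analysis.Complex.norm_logDeriv_sub_sum_le (f := riemannZeta) (c := c) (r := 7 / 4)
    (r₁ := 9 / 5) (R₂ := 37 / 20) (R := 19 / 10) (B := 40 * (|T| + 4)) (by norm_num) (by norm_num)
    (by norm_num) (by norm_num) hf hc0 hB hz hζz
  rw [logDeriv_apply] at hL
  refine hL.trans ?_
  -- the three terms
  have hN := sum_divisor_zetaDisc_le hT
  have h13 : 1 / 3 ≤ ‖riemannZeta c‖ := one_third_le_norm_riemannZeta_two_add T
  have hζc0 : 0 < ‖riemannZeta c‖ := by linarith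
  have hlogB : Real.log (40 * (|T| + 4) / ‖riemannZeta c‖) ≤ 7 * Real.log (|T| + 2) := by
    have h1 : 40 * (|T| + 4) / ‖riemannZeta c‖ ≤ 120 * (|T| + 4) := by
      rw [div_le_iff₀ hζc0]; nlinarith
    have h2 : Real.log (40 * (|T| + 4) / ‖riemannZeta c‖) ≤ Real.log (120 * (|T| + 4)) :=
      Real.log_le_log (by positivity) h1
    linarith [log_jensenBound_le hT]
  have hnum : (2 : ℝ) * (9 / 5) / ((37 / 20 - 9 / 5) * (9 / 5 - 7 / 4)) = 1440 := by norm_num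
  have hrat : Real.log (19 / 10 / (19 / 10 - 37 / 20)) = Real.log 38 := by norm_num
  rw [hnum, hrat]
  have hsum0 : 0 ≤ ∑ u ∈ ((divisor riemannZeta (closedBall c (37 / 20))).finiteSupport
      (isCompact_closedBall c (37 / 20))).toFinset,
        (divisor riemannZeta (closedBall c (37 / 20)) u : ℝ) := by
    refine Finset.sum_nonneg fun u hu ↦ ?_
    have := (zero_of_mem_support_divisor_zetaDisc hT ((Finite.mem_toFinset _).1 hu)).2.1
    exact_mod_cast this.le
  rw [mul_assoc]
  refine mul_le_mul_of_nonneg_left ?_ (by norm_num)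
  calc Real.log (40 * (|T| + 4) / ‖riemannZeta c‖) +
        (∑ u ∈ ((divisor riemannZeta (closedBall c (37 / 20))).finiteSupport
            (isCompact_closedBall c (37 / 20))).toFinset,
          (divisor riemannZeta (closedBall c (37 / 20)) u : ℝ)) * Real.log 38 + 1
      ≤ 7 * Real.log (|T| + 2) + (7 / Real.log (39 / 37) * Real.log (|T| + 2)) * Real.log 38 +
          Real.log (|T| + 2) := by
        gcongr
    _ = (8 + 7 / Real.log (39 / 37) * Real.log 38) * Real.log (|T| + 2) := by ring

/-! ## Good heights (Montgomery–Vaughan Lemma 12.2, first step) -/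

/-- **Good heights.** There is an absolute `c₀ > 0` such that every interval `[τ₀, τ₀ + 1]`
contains a `T` whose distance from the ordinate of every zero `β + iγ` of `ζ` with `β ≥ 1/4` is at
least `c₀/log(|T| + 2)` (Montgomery–Vaughan Lemma 12.2, proof: "By Theorem 10.13 … among the
`≪ log T` zeros with `T ≤ γ ≤ T + 1` there must be a gap of length `≫ 1/log T`"; here by pigeonhole
on `M + 1` equal subintervals, `M` the number of zeros in the window). [cite: MontgomeryVaughan2007, Lemma 12.2 (proof)] -/
theorem ZetaLogDerivRH.exists_goodHeight :
    ∃ c₀ : ℝ, 0 < c₀ ∧ ∀ τ₀ : ℝ, ∃ T ∈ Icc τ₀ (τ₀ + 1),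
      ∀ ρ ∈ zetaZerosRight, c₀ / Real.log (|T| + 2) ≤ |ρ.im - T| := by
  obtain ⟨C, hC0, hC⟩ := exists_sum_zetaZeroWindow_le
  refine ⟨1 / (8 * C + 8), by positivity, fun τ₀ ↦ ?_⟩
  classical
  -- the zeros of the window [τ₀, τ₀ + 1] (each once) and their number M
  set W := (zetaZeroWindow_finite (τ₀ + 1 / 2)).toFinset with hW
  set M : ℕ := W.card with hM
  have hM1 : (0 : ℝ) < M + 1 := by positivity
  -- pigeonhole: a subinterval index k not hit by any ordinate
  let φ : ℂ → ℕ := fun ρ ↦ ⌊(ρ.im - τ₀) * (M + 1)⌋₊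
  have hcard : (W.image φ).card < (Finset.range (M + 1)).card := by
    rw [Finset.card_range]
    exact Nat.lt_succ_of_le (Finset.card_image_le.trans le_rfl)
  obtain ⟨k, hk, hkφ⟩ := Finset.exists_mem_notMem_of_card_lt_card hcard
  rw [Finset.mem_range] at hk
  set T : ℝ := τ₀ + ((k : ℝ) + 1 / 2) / (M + 1) with hT
  have hk1 : (k : ℝ) + 1 ≤ M + 1 := by exact_mod_cast hk
  have hTlo : τ₀ + (1 / 2) / (M + 1) ≤ T := by
    rw [hT]; gcongr; linarith [(k.cast_nonneg : (0 : ℝ) ≤ k)]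
  have hThi : T ≤ τ₀ + 1 - (1 / 2) / (M + 1) := by
    rw [hT, add_sub_assoc, add_le_add_iff_left, le_sub_iff_add_le, ← add_div, div_le_one hM1]
    linarith
  have hδ0 : (0 : ℝ) < (1 / 2) / (M + 1) := by positivity
  refine ⟨T, ⟨by linarith, by linarith⟩, fun ρ hρ ↦ ?_⟩
  -- Step 1: every zero with β ≥ 1/4 is at distance ≥ 1/(2(M+1)) from T
  have hfar : (1 / 2) / ((M : ℝ) + 1) ≤ |ρ.im - T| := by
    by_cases hwin : |ρ.im - (τ₀ + 1 / 2)| ≤ 1 / 2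
    · -- ρ is in the window: use the pigeonhole
      have hρW : ρ ∈ W := by
        rw [hW, Set.Finite.mem_toFinset]
        exact ⟨hρ.1, hρ.2, hwin⟩
      have hne : φ ρ ≠ k := fun h ↦ hkφ (Finset.mem_image.2 ⟨ρ, hρW, h⟩)
      -- so (ρ.im - τ₀)(M+1) ∉ [k, k+1)
      set y : ℝ := (ρ.im - τ₀) * (M + 1) with hy
      have hy0 : 0 ≤ y := by
        rw [abs_le] at hwin
        have : 0 ≤ ρ.im - τ₀ := by linarith
        positivity
      have hcase : y < k ∨ (k : ℝ) + 1 ≤ y := by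
        by_contra hcon
        rw [not_or, not_lt, not_le] at hcon
        exact hne ((Nat.floor_eq_iff hy0).2 ⟨hcon.1, hcon.2⟩)
      have hyT : ρ.im - T = (y - (k + 1 / 2)) / (M + 1) := by
        rw [hT, hy]; field_simp; ring
      rw [hyT, abs_div, abs_of_pos hM1, div_le_div_iff_of_pos_right hM1]
      rcases hcase with h | h
      · rw [abs_of_neg (by linarith)]; linarith
      · rw [abs_of_nonneg (by linarith)]; linarith
    · -- ρ is outside the window
      rw [not_le] at hwin
      have h1 : |T - (τ₀ + 1 / 2)| ≤ 1 / 2 - (1 / 2) / (M + 1) := by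
        rw [abs_le]; constructor <;> linarith
      have h2 := abs_sub_abs_le_abs_sub (ρ.im - (τ₀ + 1 / 2)) (T - (τ₀ + 1 / 2))
      rw [show ρ.im - (τ₀ + 1 / 2) - (T - (τ₀ + 1 / 2)) = ρ.im - T by ring] at h2
      linarith
  -- Step 2: M ≤ C log(|τ₀ + 1/2| + 2) ≤ 2 C log(|T| + 2), so 1/(2(M+1)) ≥ c₀/log(|T|+2)
  refine le_trans ?_ hfar
  have hMle : (M : ℝ) ≤ C * Real.log (|τ₀ + 1 / 2| + 2) := by
    have h1 : (M : ℝ) = ∑ ρ ∈ W, (1 : ℝ) := by simp [hM]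
    rw [h1]
    refine le_trans (Finset.sum_le_sum fun ρ hρ ↦ ?_) (hC (τ₀ + 1 / 2))
    rw [hW, Set.Finite.mem_toFinset] at hρ
    have hρ1 := ne_one_of_riemannZeta_eq_zero hρ.1
    exact_mod_cast (riemannZetaZeroOrder_pos_iff hρ1).2 hρ.1
  have hT2 : 0 < Real.log (|T| + 2) := Real.log_pos (by linarith [abs_nonneg T])
  have hlogle : Real.log (|τ₀ + 1 / 2| + 2) ≤ 2 * Real.log (|T| + 2) := by
    have h1 : |τ₀ + 1 / 2| ≤ |T| + 1 / 2 := by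
      have := abs_sub_abs_le_abs_sub (τ₀ + 1 / 2) T
      have h3 : |τ₀ + 1 / 2 - T| ≤ 1 / 2 := by rw [abs_le]; constructor <;> linarith
      linarith
    calc Real.log (|τ₀ + 1 / 2| + 2) ≤ Real.log ((|T| + 2) ^ 2) := by
          refine Real.log_le_log (by positivity) ?_
          nlinarith [abs_nonneg T]
      _ = 2 * Real.log (|T| + 2) := by rw [Real.log_pow]; norm_num
  have hlog2 : (1 : ℝ) ≤ 2 * Real.log (|T| + 2) := by
    have : Real.log 2 ≤ Real.log (|T| + 2) := Real.log_le_log two_pos (by linarith [abs_nonneg T])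
    linarith [Real.log_two_gt_d9]
  have hM' : (M : ℝ) + 1 ≤ (2 * C + 2) * Real.log (|T| + 2) := by
    have := mul_le_mul_of_nonneg_left hlogle hC0.le
    nlinarith
  rw [div_le_div_iff₀ hT2 hM1]
  calc 1 / (8 * C + 8) * ((M : ℝ) + 1) ≤ 1 / (8 * C + 8) * ((2 * C + 2) * Real.log (|T| + 2)) :=
        mul_le_mul_of_nonneg_left hM' (by positivity)
    _ = (1 / 4) * Real.log (|T| + 2) := by field_simp; ring
    _ ≤ 1 / 2 * Real.log (|T| + 2) := by nlinarith

/-! ## Bounds for `ζ'/ζ` under RH -/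

/-- Under RH the sum over the zeros in the disc `|ρ − (2 + iT)| ≤ 37/20` is controlled by the
distance of `s` from the critical line, resp. from the ordinates: if `|s − ρ| ≥ δ > 0` for all
these zeros then `|∑_ρ m(ρ)/(s − ρ)| ≤ (7/log(39/37)) log(|T| + 2)/δ`. [folklore] -/
theorem norm_sum_divisor_zetaDisc_le {T : ℝ} (hT : 2 ≤ |T|) {z : ℂ} {δ : ℝ} (hδ : 0 < δ)
    (hfar : ∀ u ∈ Function.support (divisor riemannZeta (closedBall (2 + T * I) (37 / 20))),
      δ ≤ ‖z - u‖) :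
    ‖∑ u ∈ ((divisor riemannZeta (closedBall (2 + T * I) (37 / 20))).finiteSupport
        (isCompact_closedBall (2 + T * I) (37 / 20))).toFinset,
      (divisor riemannZeta (closedBall (2 + T * I) (37 / 20)) u : ℂ) / (z - u)‖ ≤
      (7 / Real.log (39 / 37)) * Real.log (|T| + 2) / δ := by
  refine (norm_sum_le _ _).trans ?_
  rw [le_div_iff₀ hδ, Finset.sum_mul]
  refine le_trans (Finset.sum_le_sum fun u hu ↦ ?_) (sum_divisor_zetaDisc_le hT)
  have hu' := (Finite.mem_toFinset _).1 hu
  have hpos := (zero_of_mem_support_divisor_zetaDisc hT hu').2.1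
  have hzu : 0 < ‖z - u‖ := hδ.trans_le (hfar u hu')
  rw [norm_div, Complex.norm_intCast, abs_of_pos (by exact_mod_cast hpos), div_mul_eq_mul_div,
    div_le_iff₀ hzu]
  exact mul_le_mul_of_nonneg_left (hfar u hu') (by exact_mod_cast hpos.le)

/-- Under RH, `ζ(1/4 + it) ≠ 0` for all real `t`. [folklore] -/
theorem riemannZeta_quarter_ne_zero (hRH : RiemannHypothesis) (t : ℝ) :
    riemannZeta (1 / 4 + t * I) ≠ 0 :=
  riemannZeta_ne_zero_of_riemannHypothesis hRH (by simp) (by simp)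

/-- Under RH, `t ↦ ζ'/ζ(1/4 + it)` is continuous on `ℝ`. [folklore] -/
theorem continuous_logDeriv_zeta_quarter (hRH : RiemannHypothesis) :
    Continuous fun t : ℝ ↦ deriv riemannZeta (1 / 4 + t * I) / riemannZeta (1 / 4 + t * I) := by
  have h1 : ∀ t : ℝ, (1 / 4 + (t : ℂ) * I) ≠ 1 := by
    intro t h
    have := congrArg Complex.re h
    norm_num at this
  have hpath : Continuous fun t : ℝ ↦ (1 / 4 + (t : ℂ) * I) := by fun_prop
  refine Continuous.div ?_ ?_ (riemannZeta_quarter_ne_zero hRH)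
  · refine continuous_iff_continuousAt.2 fun t ↦ ?_
    exact ((analyticOn_riemannZeta _ (h1 t)).deriv.continuousAt).comp
      (f := fun t : ℝ ↦ (1 / 4 + (t : ℂ) * I)) hpath.continuousAt
  · refine continuous_iff_continuousAt.2 fun t ↦ ?_
    exact (differentiableAt_riemannZeta (h1 t)).continuousAt.comp
      (f := fun t : ℝ ↦ (1 / 4 + (t : ℂ) * I)) hpath.continuousAt

/-- **`ζ'/ζ(1/4 + it) ≪ log(|t| + 2)` under RH.** Assume RH. There is `C > 0` such that for every
real `t`, `ζ(1/4 + it) ≠ 0` and `|ζ'/ζ(1/4 + it)| ≤ C log(|t| + 2)`. For `|t| ≥ 2` this is the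
partial fraction (`exists_norm_logDeriv_zeta_sub_sum_le`) with all zeros on `σ = 1/2`, at distance
`≥ 1/4`; for `|t| ≤ 2` continuity. (Cf. Montgomery–Vaughan Thm. 13.1, proof, and (13.6).)
[cite: MontgomeryVaughan2007, Lemma 12.1 (with RH)] -/
theorem norm_logDeriv_zeta_quarter_le (hRH : RiemannHypothesis) :
    ∃ C : ℝ, 0 < C ∧ ∀ t : ℝ, riemannZeta (1 / 4 + t * I) ≠ 0 ∧
      ‖deriv riemannZeta (1 / 4 + t * I) / riemannZeta (1 / 4 + t * I)‖ ≤
        C * Real.log (|t| + 2) := by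
  obtain ⟨C₁, hC₁0, hC₁⟩ := exists_norm_logDeriv_zeta_sub_sum_le
  have hne : ∀ t : ℝ, riemannZeta (1 / 4 + t * I) ≠ 0 :=
    riemannZeta_quarter_ne_zero hRH
  -- compact part |t| ≤ 2
  set F : ℝ → ℂ := fun t ↦ deriv riemannZeta (1 / 4 + t * I) / riemannZeta (1 / 4 + t * I) with hF
  have hFc : Continuous F := continuous_logDeriv_zeta_quarter hRH
  obtain ⟨M, hM⟩ : ∃ M, ∀ t ∈ Icc (-2 : ℝ) 2, ‖F t‖ ≤ M :=
    ⟨sSup ((fun t ↦ ‖F t‖) '' Icc (-2 : ℝ) 2), fun t ht ↦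
      (isCompact_Icc.image (hFc.norm)).isLUB_sSup (Set.image_nonempty.2 ⟨t, ht⟩) |>.1
        (Set.mem_image_of_mem _ ht)⟩
  have hM0 : 0 ≤ M := (norm_nonneg _).trans (hM 0 (by norm_num))
  have hlog2 : 0 < Real.log 2 := Real.log_pos (by norm_num)
  refine ⟨C₁ + 4 * (7 / Real.log (39 / 37)) + M / Real.log 2 + 1, by positivity, fun t ↦ ⟨hne t, ?_⟩⟩
  have hℓ2 : Real.log 2 ≤ Real.log (|t| + 2) := Real.log_le_log two_pos (by linarith [abs_nonneg t])
  have hℓ0 : 0 < Real.log (|t| + 2) := hlog2.trans_le hℓ2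
  by_cases ht : 2 ≤ |t|
  · -- partial fraction with δ = 1/4
    set z : ℂ := 1 / 4 + t * I with hz
    have hzmem : z ∈ closedBall (2 + (t : ℂ) * I) (7 / 4) := by
      rw [mem_closedBall, dist_eq_norm, hz,
        show (1 / 4 : ℂ) + t * I - (2 + t * I) = ((-(7 / 4) : ℝ) : ℂ) by push_cast; ring,
        Complex.norm_real, Real.norm_eq_abs, abs_neg, abs_of_pos (by norm_num)]
    have h1 := hC₁ t ht z hzmem (hne t)
    have hfar : ∀ u ∈ Function.support (divisor riemannZeta (closedBall (2 + (t : ℂ) * I) (37 / 20))),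
        (1 / 4 : ℝ) ≤ ‖z - u‖ := by
      intro u hu
      obtain ⟨hu0, -, -, hure⟩ := zero_of_mem_support_divisor_zetaDisc ht hu
      have hu12 := re_eq_one_half_of_riemannHypothesis hRH hu0 (by linarith)
      refine le_trans ?_ (abs_re_le_norm (z - u))
      rw [sub_re, hu12, hz]
      simp; norm_num
    have h2 := norm_sum_divisor_zetaDisc_le ht (by norm_num : (0 : ℝ) < 1 / 4) hfar

    calc ‖F t‖ = ‖(deriv riemannZeta z / riemannZeta z -
            ∑ u ∈ ((divisor riemannZeta (closedBall (2 + (t : ℂ) * I) (37 / 20))).finiteSupport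
                (isCompact_closedBall (2 + (t : ℂ) * I) (37 / 20))).toFinset,
              (divisor riemannZeta (closedBall (2 + (t : ℂ) * I) (37 / 20)) u : ℂ) / (z - u)) +
            ∑ u ∈ ((divisor riemannZeta (closedBall (2 + (t : ℂ) * I) (37 / 20))).finiteSupport
                (isCompact_closedBall (2 + (t : ℂ) * I) (37 / 20))).toFinset,
              (divisor riemannZeta (closedBall (2 + (t : ℂ) * I) (37 / 20)) u : ℂ) / (z - u)‖ := by
          rw [sub_add_cancel]
      _ ≤ C₁ * Real.log (|t| + 2) + (7 / Real.log (39 / 37)) * Real.log (|t| + 2) / (1 / 4) :=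
          (norm_add_le _ _).trans (add_le_add h1 h2)
      _ ≤ (C₁ + 4 * (7 / Real.log (39 / 37)) + M / Real.log 2 + 1) * Real.log (|t| + 2) := by
          have : 0 ≤ (M / Real.log 2 + 1) * Real.log (|t| + 2) := by positivity
          nlinarith
  · rw [not_le] at ht
    have htI : t ∈ Icc (-2 : ℝ) 2 := by rw [mem_Icc, ← abs_le]; exact ht.le
    calc ‖F t‖ ≤ M := hM t htI
      _ = M / Real.log 2 * Real.log 2 := by field_simp
      _ ≤ M / Real.log 2 * Real.log (|t| + 2) := by gcongr
      _ ≤ (C₁ + 4 * (7 / Real.log (39 / 37)) + M / Real.log 2 + 1) * Real.log (|t| + 2) := by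
          have : 0 ≤ (C₁ + 4 * (7 / Real.log (39 / 37)) + 1) * Real.log (|t| + 2) := by positivity
          nlinarith

/-- **`ζ'/ζ(σ + iT) ≪ log² T` on good heights, under RH** (Montgomery–Vaughan Lemma 12.2 for
`1/4 ≤ σ ≤ 2`). Assume RH and let `c₀ > 0`. There is `C > 0` such that for every `T` with
`|T| ≥ 2` all of whose distances from ordinates of zeros `β + iγ`, `β ≥ 1/4`, are
`≥ c₀/log(|T| + 2)`, and every `σ ∈ [1/4, 2]`: `ζ(σ + iT) ≠ 0` and
`|ζ'/ζ(σ + iT)| ≤ C log²(|T| + 2)`. [cite: MontgomeryVaughan2007, Lemma 12.2] -/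
theorem norm_logDeriv_zeta_le_of_goodHeight (hRH : RiemannHypothesis) {c₀ : ℝ} (hc₀ : 0 < c₀) :
    ∃ C : ℝ, 0 < C ∧ ∀ T : ℝ, 2 ≤ |T| →
      (∀ ρ ∈ zetaZerosRight, c₀ / Real.log (|T| + 2) ≤ |ρ.im - T|) →
      ∀ σ ∈ Icc (1 / 4 : ℝ) 2, riemannZeta (σ + T * I) ≠ 0 ∧
        ‖deriv riemannZeta (σ + T * I) / riemannZeta (σ + T * I)‖ ≤
          C * Real.log (|T| + 2) ^ 2 := by
  obtain ⟨C₁, hC₁0, hC₁⟩ := exists_norm_logDeriv_zeta_sub_sum_le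
  refine ⟨C₁ + (7 / Real.log (39 / 37)) / c₀, by
    have := Real.log_pos (show (1 : ℝ) < 39 / 37 by norm_num); positivity, ?_⟩
  intro T hT hgood σ hσ
  have hℓ : 1 ≤ Real.log (|T| + 2) := by
    rw [← Real.log_exp 1]
    refine Real.log_le_log (Real.exp_pos 1) ?_
    have := Real.exp_one_lt_d9
    linarith [abs_nonneg T]
  have hℓ0 : 0 < Real.log (|T| + 2) := by linarith
  have hδ : 0 < c₀ / Real.log (|T| + 2) := by positivity
  set z : ℂ := σ + T * I with hz
  -- ζ(z) ≠ 0: a zero would be on the critical line with ordinate T, at distance 0 from T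
  have hζz : riemannZeta z ≠ 0 := by
    intro h0
    have hre : z.re = 1 / 2 := re_eq_one_half_of_riemannHypothesis hRH h0 (by
      rw [hz]; simp; linarith [hσ.1])
    have hmem : z ∈ zetaZerosRight := ⟨h0, by rw [hre]; norm_num⟩
    have := hgood z hmem
    rw [hz] at this
    simp at this
    linarith
  refine ⟨hζz, ?_⟩
  have hzmem : z ∈ closedBall (2 + (T : ℂ) * I) (7 / 4) := by
    rw [mem_closedBall, dist_eq_norm, hz,
      show (σ : ℂ) + T * I - (2 + T * I) = ((σ - 2 : ℝ) : ℂ) by push_cast; ring,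
      Complex.norm_real, Real.norm_eq_abs, abs_le]
    constructor <;> linarith [hσ.1, hσ.2]
  have h1 := hC₁ T hT z hzmem hζz
  have hfar : ∀ u ∈ Function.support (divisor riemannZeta (closedBall (2 + (T : ℂ) * I) (37 / 20))),
      c₀ / Real.log (|T| + 2) ≤ ‖z - u‖ := by
    intro u hu
    obtain ⟨hu0, -, -, hure⟩ := zero_of_mem_support_divisor_zetaDisc hT hu
    have hu12 := re_eq_one_half_of_riemannHypothesis hRH hu0 (by linarith)
    have humem : u ∈ zetaZerosRight := ⟨hu0, by rw [hu12]; norm_num⟩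
    have h2 := hgood u humem
    refine le_trans ?_ (abs_im_le_norm (z - u))
    rw [sub_im, hz]
    simpa [abs_sub_comm] using h2
  have h2 := norm_sum_divisor_zetaDisc_le hT hδ hfar
  calc ‖deriv riemannZeta z / riemannZeta z‖
      = ‖(deriv riemannZeta z / riemannZeta z -
            ∑ u ∈ ((divisor riemannZeta (closedBall (2 + (T : ℂ) * I) (37 / 20))).finiteSupport
                (isCompact_closedBall (2 + (T : ℂ) * I) (37 / 20))).toFinset,
              (divisor riemannZeta (closedBall (2 + (T : ℂ) * I) (37 / 20)) u : ℂ) / (z - u)) +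
          ∑ u ∈ ((divisor riemannZeta (closedBall (2 + (T : ℂ) * I) (37 / 20))).finiteSupport
              (isCompact_closedBall (2 + (T : ℂ) * I) (37 / 20))).toFinset,
            (divisor riemannZeta (closedBall (2 + (T : ℂ) * I) (37 / 20)) u : ℂ) / (z - u)‖ := by
        rw [sub_add_cancel]
    _ ≤ C₁ * Real.log (|T| + 2) +
          (7 / Real.log (39 / 37)) * Real.log (|T| + 2) / (c₀ / Real.log (|T| + 2)) :=
        (norm_add_le _ _).trans (add_le_add h1 h2)
    _ = C₁ * Real.log (|T| + 2) + (7 / Real.log (39 / 37)) / c₀ * Real.log (|T| + 2) ^ 2 := by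
        field_simp
    _ ≤ (C₁ + (7 / Real.log (39 / 37)) / c₀) * Real.log (|T| + 2) ^ 2 := by
        have h3 : Real.log (|T| + 2) ≤ Real.log (|T| + 2) ^ 2 := by nlinarith
        nlinarith [mul_le_mul_of_nonneg_left h3 hC₁0.le]

end Literature.NumberTheory.LFunctions

end
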